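import Literature.Probability.LatticeModels.UniformBHPFromCrossRatio
import Literature.Probability.LatticeModels.EdgeKilledBeurling
import HarnessLib

/-!
# Outer exit bound for the lattice germ region from the middle box (line `symplectic-fermion-anchor`,
crux `SAWLoopFugacityFlow.AvoidanceLimit`, stmt-CriticalPhenomena-10649)

The harmonic-measure input of the hub construction (Chelkak 2016, Lemma 3.4) for the edge-killed walk
`Ω^δ = discreteDomainGraph D δ` of a Jordan domain `D` in the lattice GERM REGION
`Θ = germSites D b s' g o δ` about a boundary point `b ∈ ∂D` (`GermRegionLattice.lean`): from every site
`v ∈ Θ` of the middle box `|δv - b|_∞ ≤ s'/8` the walk leaves `Θ` alive — necessarily through an exit of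
`Θ`, and the exits lie within mesh distance `δ` of the far-away square `∂(box b s')`
(`sup_norm_germExit`) — with probability at most `1 - c_*`, `c_* = maneuverConst`:

  `∑_{x ∈ E} killedPoisson (Ω^δ) Θ v x ≤ 1 - maneuverConst`   (`E ⊆ germExits`).

Proof: with `k = ⌊s'/(96δ)⌋ + 1` the box `mW v k` (sup-radius `48k` lattice units about `v`) contains no
exit, so on `Θ ∩ mW v k` the exit mass `f = ∑_{x∈E} killedPoisson Θ (·) x` (killed-harmonic, `≤ 1`,
`= 𝟙_E = 0` on `mW v k ∖ Θ`) is dominated by the survival probability `edgeSurvive (Ω^δ) (mW v k)`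
(comparison principle of `KilledWalkLaplacian.lean`), which the annulus maneuver
`JordanDomain.edgeKilled_survive_le` bounds by `1 - c_*` at `v` because the boundary point `b` lies in
the open box of radius `12k > s'/(8δ)` about `v`.

Everything is proved; no definitions. Source: D. Chelkak, *Robust discrete complex analysis: a toolbox*,
Ann. Probab. 44 (2016), Lemma 3.4 and Lemma 2.11 [Chelkak2016]; S. Smirnov, Ann. of Math. 172 (2010),
Lemma B.2 [Smirnov2010].
-/

noncomputable section

open scoped BigOperators Topology Classical
open Filter Finset
open Literature.Probability.RandomPlanarGeometry Literature.Probability.LatticeModels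
open Literature.Topology.PlaneTopology (closedBox boxJD TwoOff)

namespace Summit.CriticalPhenomena.SAWScalingLimit.Theorems.AvoidanceLimit.Anchor

/-- A finite sum of Poisson kernels `z ↦ ∑_{x ∈ E} killedPoisson Gr S z x` of the killed walk in a
finite set `S` is killed-harmonic on `S`. [folklore] -/
theorem outerExit_isKilledHarmonicOn_sum_killedPoisson (Gr : SimpleGraph (Site 2)) {S : Set (Site 2)}
    (hS : S.Finite) (E : Finset (Site 2)) :
    IsKilledHarmonicOn Gr (fun z => ∑ x ∈ E, killedPoisson Gr S z x) S := by
  induction E using Finset.induction_on with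
  | empty => simpa using isKilledHarmonicOn_zero (Gr := Gr) S
  | insert a s ha ih =>
    simp only [Finset.sum_insert ha]
    exact (killedPoisson_harmonicOn hS a).add ih

/-- The exit mass through a set `E` of exits is at most one everywhere:
`∑_{x ∈ E} killedPoisson Gr S z x ≤ 1` for `E ⊆ ∂S` (inside `S` by `sum_killedPoisson_le_one` and the
nonnegativity of the dropped terms; off `S` the sum is the indicator of `E`). [folklore] -/
theorem outerExit_sum_killedPoisson_le_one (Gr : SimpleGraph (Site 2)) {S : Set (Site 2)}
    (hS : S.Finite) {E : Finset (Site 2)} (hE : (↑E : Set (Site 2)) ⊆ killedOuterBoundary Gr S)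
    (z : Site 2) : ∑ x ∈ E, killedPoisson Gr S z x ≤ 1 := by
  by_cases hz : z ∈ S
  · have hEB : E ⊆ (killedOuterBoundary_finite (Gr := Gr) hS).toFinset := fun x hx => by
      rw [Set.Finite.mem_toFinset]; exact hE hx
    calc ∑ x ∈ E, killedPoisson Gr S z x
        ≤ ∑ x ∈ (killedOuterBoundary_finite (Gr := Gr) hS).toFinset, killedPoisson Gr S z x :=
          Finset.sum_le_sum_of_subset_of_nonneg hEB fun x _ _ => killedPoisson_nonneg hS z x
      _ ≤ 1 := sum_killedPoisson_le_one hS z hz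
  · rw [Finset.sum_congr rfl fun x _ => killedPoisson_of_not_mem (Gr := Gr) hz x, Finset.sum_ite_eq]
    split_ifs <;> norm_num

/-- **Outer exit bound from the middle box** (harmonic-measure input of the hub, Chelkak 2016,
Lemma 3.4, for the edge-killed walk in the lattice germ region). Let `b ∈ ∂D`, `0 < 400δ ≤ s'`,
`Θ = germSites D b s' g o δ` (with the side conditions of `sup_norm_germExit`: `TwoOff`, `g ∈ D ∩ box b s'`,
`o ∈ D ∖ closedBox b s'`), `v ∈ Θ` with `|δv - b|_∞ ≤ s'/8`, and `E ⊆ germExits` a finite set of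
exits. Then `∑_{x ∈ E} killedPoisson (Ω^δ) Θ v x ≤ 1 - maneuverConst`: to reach an exit (sup-distance
`≥ s' - δ` from `b`) the walk must leave the box of sup-radius `48k` lattice units about `v`,
`k = ⌊s'/(96δ)⌋ + 1`, alive, and the annulus maneuver about the boundary point `b` (in the open box
of radius `12k` about `v`) kills it with probability `≥ maneuverConst`. [cite: Chelkak2016, Lemma 3.4] -/
theorem sum_killedPoisson_germExits_le :
    ∀ (D : JordanDomain) (b : ℂ) (s' : ℝ) (hs' : 0 < s') (g o : ℂ) (δ : ℝ), 0 < δ → 400 * δ ≤ s' →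
      b ∈ frontier D.carrier → TwoOff D (boxJD b hs') →
      g ∈ D.carrier ∩ Literature.Topology.PlaneTopology.box b s' → o ∈ D.carrier → o ∉ closedBox b s' →
      ∀ v ∈ germSites D b hs' g o δ,
        |(meshPoint δ v).re - b.re| ≤ s' / 8 → |(meshPoint δ v).im - b.im| ≤ s' / 8 →
      ∀ (E : Finset (Site 2)), (↑E : Set (Site 2)) ⊆ germExits D b hs' g o δ →
        ∑ x ∈ E, killedPoisson (discreteDomainGraph D.carrier δ) (germSites D b hs' g o δ) v x ≤
          1 - maneuverConst := by
  intro D b s' hs' g o δ hδ h400 hb h2 hg ho hoc v hv hvre hvim E hE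
  set Gr := discreteDomainGraph D.carrier δ with hGr
  set Θ := germSites D b hs' g o δ with hΘ
  have hΘfin : Θ.Finite := germSites_finite hδ
  rw [meshPoint_re] at hvre
  rw [meshPoint_im] at hvim
  -- the scale `k`: `s' < 96 k δ ≤ s' + 96 δ`
  set k : ℕ := ⌊s' / (96 * δ)⌋₊ + 1 with hk
  have hkpos : 0 < k := Nat.succ_pos _
  have h96 : (0 : ℝ) < 96 * δ := by positivity
  have hkR : (k : ℝ) = ⌊s' / (96 * δ)⌋₊ + 1 := by rw [hk]; push_cast; ring
  have hk1 : s' < 96 * k * δ := by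
    have h := Nat.lt_floor_add_one (s' / (96 * δ))
    rw [← hkR, div_lt_iff₀ h96] at h
    linarith
  have hk2 : 96 * k * δ ≤ s' + 96 * δ := by
    have h := Nat.floor_le (show (0 : ℝ) ≤ s' / (96 * δ) by positivity)
    have h' : (k : ℝ) - 1 ≤ s' / (96 * δ) := by rw [hkR]; linarith
    rw [le_div_iff₀ h96] at h'
    linarith
  -- the exit mass `f` and the survival probability of the box `mW v k`
  set f : Site 2 → ℝ := fun z => ∑ x ∈ E, killedPoisson Gr Θ z x with hf
  have hf_harm : IsKilledHarmonicOn Gr f Θ := outerExit_isKilledHarmonicOn_sum_killedPoisson Gr hΘfin E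
  have hf_le : ∀ z, f z ≤ 1 := fun z => outerExit_sum_killedPoisson_le_one Gr hΘfin hE z
  have hW_harm : IsKilledHarmonicOn Gr (edgeSurvive Gr (mW v k)) (mW v k) := by
    unfold edgeSurvive
    exact killedHarmExt_harmonicOn (mW_finite v k) _
  -- no exit lies in the box `mW v k`: exits are at sup-distance `≥ s' - δ` from `b`
  have hfar : ∀ x ∈ E, x ∉ mW v k := by
    intro x hxE hxW
    have hx := (sup_norm_germExit h2 hg ho hoc hδ (hE hxE)).2
    apply hx
    rw [Literature.Topology.PlaneTopology.mem_box_iff_abs, meshPoint_re, meshPoint_im]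
    obtain ⟨h0, h1⟩ := hxW
    have h0' : |((x 0 : ℤ) : ℝ) - v 0| ≤ 48 * k := by exact_mod_cast h0
    have h1' : |((x 1 : ℤ) : ℝ) - v 1| ≤ 48 * k := by exact_mod_cast h1
    rw [abs_le] at h0' h1' hvre hvim
    have h0a := mul_le_mul_of_nonneg_left h0'.1 hδ.le
    have h0b := mul_le_mul_of_nonneg_left h0'.2 hδ.le
    have h1a := mul_le_mul_of_nonneg_left h1'.1 hδ.le
    have h1b := mul_le_mul_of_nonneg_left h1'.2 hδ.le
    refine ⟨abs_lt.2 ⟨?_, ?_⟩, abs_lt.2 ⟨?_, ?_⟩⟩ <;> nlinarith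
  -- comparison on `Θ ∩ mW v k`
  have hcomp : ∀ z ∈ Θ ∩ mW v k, f z ≤ edgeSurvive Gr (mW v k) z := by
    refine le_of_killedSub_killedSuper_of_boundary (hΘfin.subset Set.inter_subset_left)
      (hf_harm.mono Set.inter_subset_left).subharmonicOn
      (hW_harm.mono Set.inter_subset_right).superharmonicOn fun w hw => ?_
    by_cases hwW : w ∈ mW v k
    · have hwΘ : w ∉ Θ := fun h => hw.1 ⟨h, hwW⟩
      have h0 : f w = 0 := Finset.sum_eq_zero fun x hx => by
        rw [killedPoisson_of_not_mem hwΘ, if_neg]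
        rintro rfl
        exact hfar w hx hwW
      rw [h0]
      exact (edgeSurvive_mem_Icc (mW_finite v k) w).1
    · rw [edgeSurvive_of_not_mem hwW]
      exact hf_le w
  -- the annulus maneuver about `b`
  have hvB : v ∈ mB v k := by
    simp only [mB, Set.mem_setOf_eq, sub_self, abs_zero]
    constructor <;> positivity
  have hp0 : |b.re / δ - v 0| < 12 * k := by
    have h : b.re / δ - v 0 = (b.re - δ * v 0) / δ := by field_simp
    rw [h, abs_div, abs_of_pos hδ, div_lt_iff₀ hδ, abs_sub_comm]
    linarith
  have hp1 : |b.im / δ - v 1| < 12 * k := by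
    have h : b.im / δ - v 1 = (b.im - δ * v 1) / δ := by field_simp
    rw [h, abs_div, abs_of_pos hδ, div_lt_iff₀ hδ, abs_sub_comm]
    linarith
  calc f v ≤ edgeSurvive Gr (mW v k) v := hcomp v ⟨hv, mB_subset_mW hvB⟩
    _ ≤ 1 - maneuverConst := D.edgeKilled_survive_le hδ hkpos hb hp0 hp1 hvB

end Summit.CriticalPhenomena.SAWScalingLimit.Theorems.AvoidanceLimit.Anchor

end
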